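import Summits.KontsevichZagierPeriods.Zeta5Search.LaiSweepShard

/-!
# `κ₃` sweep certificate — shard file 101 of 127 (shards 707–713 of 889)

HONEST FRAMING. Systematic search; no irrationality claim unless certified. This file only checks,
by `decide +kernel`, shards 707–713 of the order-cell sweep of the `κ₃` point `(74, 2180, 444; δ74)`
(engine `LaiSweepEngine`, soundness `LaiSweepJump/Free/Eval/Shard/Kappa3`; a shard is `⟨regime, n,
p, q, p', q', Lo, Up⟩`: `n` cells from `p/q` to `p'/q'` with integer rate sums in `[Lo, Up]`, `K =
128`, `D = 2^40`). It draws NO conclusion: only the capstone `LaiKappa3SweepCert`, which needs all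
127 shard files, does. Kernel cost of this file ≈ 560 cells × 0.3 s.
-/

namespace Summit.KontsevichZagierPeriods.Zeta5Search.Sweep

set_option maxHeartbeats 100000000 in
/-- Shard 707: 80 cells of regime B from `260/337` to `17/22`.
[cite: Lai2024BallRivoal, §4 Lemma 4.3] -/
theorem shard707 :
    Shard.check 128 (2^40)
      ⟨true, 80, 260, 337, 17, 22, 10975459774508, 16668337878985⟩ = true := by
  decide +kernel

set_option maxHeartbeats 100000000 in
/-- Shard 708: 80 cells of regime B from `17/22` to `250/323`.
[cite: Lai2024BallRivoal, §4 Lemma 4.3] -/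
theorem shard708 :
    Shard.check 128 (2^40)
      ⟨true, 80, 17, 22, 250, 323, 11438601790518, 17389820595943⟩ = true := by
  decide +kernel

set_option maxHeartbeats 100000000 in
/-- Shard 709: 80 cells of regime B from `250/323` to `307/396`.
[cite: Lai2024BallRivoal, §4 Lemma 4.3] -/
theorem shard709 :
    Shard.check 128 (2^40)
      ⟨true, 80, 250, 323, 307, 396, 11364199459242, 17294965839708⟩ = true := by
  decide +kernel

set_option maxHeartbeats 100000000 in
/-- Shard 710: 80 cells of regime B from `307/396` to `271/349`.
[cite: Lai2024BallRivoal, §4 Lemma 4.3] -/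
theorem shard710 :
    Shard.check 128 (2^40)
      ⟨true, 80, 307, 396, 271, 349, 11289007428547, 17198585097420⟩ = true := by
  decide +kernel

set_option maxHeartbeats 100000000 in
/-- Shard 711: 80 cells of regime B from `271/349` to `3737/4804`.
[cite: Lai2024BallRivoal, §4 Lemma 4.3] -/
theorem shard711 :
    Shard.check 128 (2^40)
      ⟨true, 80, 271, 349, 3737, 4804, 12516529501599, 19090051709208⟩ = true := by
  decide +kernel

set_option maxHeartbeats 100000000 in
/-- Shard 712: 80 cells of regime B from `3737/4804` to `67/86`.
[cite: Lai2024BallRivoal, §4 Lemma 4.3] -/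
theorem shard712 :
    Shard.check 128 (2^40)
      ⟨true, 80, 3737, 4804, 67, 86, 10584048016492, 16159863097918⟩ = true := by
  decide +kernel

set_option maxHeartbeats 100000000 in
/-- Shard 713: 80 cells of regime B from `67/86` to `341/437`.
[cite: Lai2024BallRivoal, §4 Lemma 4.3] -/
theorem shard713 :
    Shard.check 128 (2^40)
      ⟨true, 80, 67, 86, 341, 437, 11241928251299, 17181684350484⟩ = true := by
  decide +kernel

/-- The checked shards of this file, in order. [folklore] -/
def shards101 : List (CheckedShard 128 (2^40)) :=
  [⟨_, shard707⟩, ⟨_, shard708⟩, ⟨_, shard709⟩, ⟨_, shard710⟩, ⟨_, shard711⟩,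
    ⟨_, shard712⟩, ⟨_, shard713⟩]

end Summit.KontsevichZagierPeriods.Zeta5Search.Sweep
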